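import Summits.BirchSwinnertonDyer.BirchSwinnertonDyer.Theorems.SignedLowerHalvesSmallImageLowerHalfBothSignsRttD2SeqSemilocPairLawsRed
import Summits.BirchSwinnertonDyer.BirchSwinnertonDyer.Theorems.SignedLowerHalvesSmallImageLowerHalfBothSignsRttD2SeqSemilocData
import Summits.BirchSwinnertonDyer.BirchSwinnertonDyer.Theorems.SignedLowerHalvesSmallImageLowerHalfBothSignsRttD2SeqJ3TorsionLevels
import HarnessLib

/-!
# Route `SignedLowerHalves`, crux L `SmallImageLowerHalfBothSigns` (stmt-BirchSwinnertonDyer-23599), line `rtt_w3` v30 — stub S3β″ (`stub_junctionPT_ns`, row J4′,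
# Poitou–Tate half), brick N2b: THE SEMILOCAL LAYER PAIRING `𝐇¹_{Iw,w} × H¹(Gal(K̄/K_n), M) → ℚ/ℤ` —
# `⟨h, c⟩_{w,n} := ⟨proj_{n,k} h, semilocDual ℓ⟩_{w,n,k} / p^k` for ANY torsion-level lift `ℓ ∈ H¹(U_n, M[p^k])` of `c`, and its laws

WIDTH seat `bsd-line-slh-p3-w3` g26 under LEAD `cruxlead-stmt-BirchSwinnertonDyer-23599` g14 (cell `bsd-ssimc`); helper `--supports stmt-BirchSwinnertonDyer-23599`
(design memo `Lines/rtt_w3-DESIGN-S3beta-w3-g25.md`, rev 4 §6 RECIPE N2b). DEFINITIONS WITH BODIES (`semilocPairNKQ`, the `ℚ/ℤ`-valued level pairing as an additive map in the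
A-side class; `SemilocIwasawaCohomologyDataO.pairLevel/liftLevel/lift/pairLayerFun/pairLayer`) + THEOREMS; no named fact, no instance, no `sorry`. The GLOBAL-LAYER twin of g22's
`LayerPairing.pairLayer` (p784142, local layers at `v`): the A-side classes are now classes of the GLOBAL layers `U_n = Gal(K̄/K_n)`, the B-side is the semilocal Iwasawa module
`L_w.H = 𝐇¹_{Iw,w}` (T1-b₂ p811191) instead of honda's `I.H`, and the four laws are the tree's L1–L4 of `semilocPairNK` (p813524/p813825 + L2 `…SemilocPairLawsRed`).
HONEST FRAMING: bookkeeping for the semilocal tower pairing `Φ` (brick N2 of S3β″); nothing about S3β″, S3α′, crux L or BSD is proved; all remain OPEN and are proved for NO curve.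

WHAT.
* §1 `semilocPairNKQ … w n k t : H¹(U_n, M[p^k]) →+ ℚ/ℤ`, `c ↦ ⟨t, semilocDual c⟩_{w,n,k} / p^k` (additive in `c` AND in `t`), and the four laws read in `ℚ/ℤ` and in the tree-side
  (`subgroupH1`/`torsIncl`/`resOfLe`/`conjH1`/`torsScalar`) currency: `semilocPairNKQ_semilocCores` (L1), `semilocPairNKQ_torsIncl` (L2), `semilocPairNKQ_semilocConj` (L3),
  `semilocPairNKQ_semilocScalar` (L4); `torsIncl_le_refl`, `compactSpace_layerSubgroup`.
* §2 for `L : SemilocIwasawaCohomologyDataO … w 1` and `h ∈ L.H`: `L.pairLevel … n k h := semilocPairNKQ … (L.proj n k h)`, ★ `pairLevel_torsIncl` (independence of the torsion level along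
  `torsIncl`, from L2 + (P2)), ★★ `pairLevel_eq_of_torsToH1_eq` (two lifts of the same class of `H¹(U_n, M)` pair equally: kernel control `exists_torsIncl_eq_zero_of_torsToH1_eq_zero`),
  ★★ `L.pairLayer … n : L.H →+ (H¹(U_n, M) →+ ℚ/ℤ)` (exhaustion `exists_torsToH1_eq`, `U_n` compact, `M` `p`-primary) with `pairLayer_apply_torsToH1`.
* §3 LAWS of `pairLayer`: ★ `pairLayer_resOfLe` (compatibility with restriction `U_m ≤ U_n`: L1 + (P1) + `torsToH1_resOfLe`), ★ `pairLayer_X_smul` (`⟨T·h, c⟩ = ⟨h, conj_{γ⁻¹} c⟩ − ⟨h, c⟩`: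
  (P5) + L3 + `torsToH1_conjH1`), ★ `pairLayer_C_smul` (`⟨C a·h, c⟩ = ⟨h, a·c⟩`: (P7) + L4 + `torsToH1_torsScalar`, given `hPsc`).
References: [Rubin2000] §4.2, App. B.2–B.3; [NeukirchSchmidtWingberg2008] I §5 Prop. (1.5.3)(iv), (7.2.6), (8.6.2); [PerrinRiou1994Invent] §3.6.1; [Kato2004Asterisque] §17.13;
[SerreGaloisCohomology1997] I §2.2.
-/

set_option autoImplicit false
set_option linter.dupNamespace false -- D-0017: single-problem summit, the namespace repeats the problem name by design
noncomputable section

open scoped Classical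
open CategoryTheory Function NumberField IsDedekindDomain Field

namespace Summit.BirchSwinnertonDyer.BirchSwinnertonDyer.Theorems.SmallImageRttD2Seq

open Literature.NumberTheory.GaloisRepresentations Literature.NumberTheory.GaloisCohomology Literature.NumberTheory.EllipticCurves
  Literature.NumberTheory.ComplexMultiplication.EllipticUnits Literature.NumberTheory.ComplexMultiplication.EllipticUnits.JohnsonLeungKings2011
  Literature.NumberTheory.GaloisRepresentations.DiscreteGaloisModule Literature.NumberTheory.GaloisCohomology.PoitouTateFinite
  Literature.AnabelianGeometry.AbsoluteAnabelian.Prop121vii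
  Summit.BirchSwinnertonDyer.BirchSwinnertonDyer.Theorems.SmallImageRttD2J1

/-! ## §1. The `ℚ/ℤ`-valued semilocal level pairing and its four laws in the tree-side currency -/

section TorsInclAlgebra

variable {G : Type} [Group G] [TopologicalSpace G] [IsTopologicalGroup G]
  (M : Type) [AddCommGroup M] [DistribMulAction G M] [TopologicalSpace M] [DiscreteTopology M] (p : ℕ) (U : Subgroup G)

/-- `torsIncl` along `k ≤ k` is the identity. [folklore] -/
theorem torsIncl_le_refl (k : ℕ) (ℓ : subgroupH1 U ↥(torsionPow M p k)) : torsIncl M p U (le_refl k) ℓ = ℓ := by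
  have h : torsIncl M p U (le_refl k) = AddMonoidHom.id _ := by
    rw [torsIncl, resH1Hom_congr (ψ' := AddMonoidHom.id _) rfl (by ext; rfl) _ (fun _ _ ↦ rfl), resH1Hom_id]
  rw [h, AddMonoidHom.id_apply]

end TorsInclAlgebra

section LevelQ

variable {K : Type} [Field K] [NumberField K] {p : ℕ} [Fact p.Prime] (S : Set (PadicAlgCl p)) [FiniteDimensional ℚ_[p] (padicCoeffField S)] (κ : ZpExtension K p)
  (θ' : absoluteGaloisGroup K →ₜ* (padicCoeffIntegers S)ˣ) (P : Set (HeightOneSpectrum (𝓞 K)))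
  (M : Type) [AddCommGroup M] [TopologicalSpace M] [DiscreteTopology M] [DistribMulAction (absoluteGaloisGroup K) M]
  (hstabK : ∀ m : M, IsOpen (MulAction.stabilizer (absoluteGaloisGroup K) m : Set (absoluteGaloisGroup K)))
  (PG : ∀ k : ℕ, ContPairing (coeffRepK S θ' P k).toTopRep (torsRep M hstabK p k).toTopRep (mu K (p ^ k)).toTopRep)
  (w : HeightOneSpectrum (𝓞 K))

omit [NumberField K] in
/-- `Gal(K̄/K_n)` is compact (open, hence closed, in the compact `Γ_K`) — the hypothesis of the exhaustion `exists_torsToH1_eq`. [cite: SerreGaloisCohomology1997, I §2.2] -/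
theorem compactSpace_layerSubgroup (n : ℕ) : CompactSpace ↥(κ.layerSubgroup n) := by
  haveI : CompactSpace (absoluteGaloisGroup K) := absoluteGaloisGroup_compactSpace K
  exact isCompact_iff_compactSpace.mp ((κ.layerSubgroup n).isClosed_of_isOpen (κ.isOpen_layerSubgroup n)).isCompact

/-- `semilocDual` is additive in the layer class. [folklore] -/
theorem semilocDual_add (n k : ℕ) (c c' : continuousCohomology 1 (subgroupRep (torsRep M hstabK p k).toTopRep (κ.layerSubgroup n))) :
    semilocDual S κ θ' P M hstabK PG w n k (c + c') = semilocDual S κ θ' P M hstabK PG w n k c + semilocDual S κ θ' P M hstabK PG w n k c' := by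
  simp only [semilocDual, map_add]
  exact map_add (galoisCohomology.localization _ _ 1) _ _

/-- `semilocDual 0 = 0`. [folklore] -/
theorem semilocDual_zero (n k : ℕ) :
    semilocDual S κ θ' P M hstabK PG w n k (0 : continuousCohomology 1 (subgroupRep (torsRep M hstabK p k).toTopRep (κ.layerSubgroup n))) = 0 := by
  simp only [semilocDual, map_zero]
  exact map_zero (galoisCohomology.localization _ _ 1)

/-- `semilocPairNK` is additive in the A-side class. [cite: MilneADT2006, Ch. I, Cor. 2.3] -/
theorem semilocPairNK_add_right (n k : ℕ) (t : semilocCoh S κ θ' P w n k 1)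
    (c c' : continuousCohomology 1 (subgroupRep (torsRep M hstabK p k).toTopRep (κ.layerSubgroup n))) :
    semilocPairNK S κ θ' P M hstabK PG w n k t (c + c') = semilocPairNK S κ θ' P M hstabK PG w n k t c + semilocPairNK S κ θ' P M hstabK PG w n k t c' := by
  simp only [semilocPairNK, semilocDual_add, map_add]

/-- `semilocPairNK t 0 = 0`. [folklore] -/
theorem semilocPairNK_zero_right (n k : ℕ) (t : semilocCoh S κ θ' P w n k 1) :
    semilocPairNK S κ θ' P M hstabK PG w n k t (0 : continuousCohomology 1 (subgroupRep (torsRep M hstabK p k).toTopRep (κ.layerSubgroup n))) = 0 := by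
  simp only [semilocPairNK, semilocDual_zero, map_zero]

/-- `semilocPairNK` is additive in the semilocal class. [cite: MilneADT2006, Ch. I, Cor. 2.3] -/
theorem semilocPairNK_add_left (n k : ℕ) (t t' : semilocCoh S κ θ' P w n k 1)
    (c : continuousCohomology 1 (subgroupRep (torsRep M hstabK p k).toTopRep (κ.layerSubgroup n))) :
    semilocPairNK S κ θ' P M hstabK PG w n k (t + t') c = semilocPairNK S κ θ' P M hstabK PG w n k t c + semilocPairNK S κ θ' P M hstabK PG w n k t' c := by
  letI := layerQuotFintype κ n
  haveI := finite_oMuCarrier (K := K) S k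
  haveI : NeZero (p ^ k) := ⟨pow_ne_zero _ (Fact.out : p.Prime).ne_zero⟩
  simp only [semilocPairNK]
  exact DFunLike.congr_fun (map_add (localTatePairingZMod (DiscreteGaloisModule.coind (coeffRepK S θ' P k) (κ.layerSubgroup n) (κ.isOpen_layerSubgroup n)) (p ^ k) (Sum.inr w)
    (LocalInvariants.canonical K (p ^ k) (Sum.inr w))) t t') _

/-- ★ **The `ℚ/ℤ`-valued semilocal level pairing** `c ↦ ⟨t, semilocDual c⟩_{w,n,k} / p^k`, `H¹(U_n, M[p^k]) →+ ℚ/ℤ`, for a semilocal class `t ∈ Lloc_w(n,k)` (tree-side currency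
`subgroupH1 (κ.layerSubgroup n) M[p^k]` on the A-side — definitionally honda's `continuousCohomology 1 (subgroupRep (torsRep …) U_n)`). [cite: MilneADT2006, Ch. I, Cor. 2.3]
[cite: Rubin2000, §4.2] -/
def semilocPairNKQ (n k : ℕ) (t : semilocCoh S κ θ' P w n k 1) : subgroupH1 (κ.layerSubgroup n) ↥(torsionPow M p k) →+ AddCircle (1 : ℚ) :=
  haveI : NeZero (p ^ k) := ⟨pow_ne_zero _ (Fact.out : p.Prime).ne_zero⟩
  { toFun := fun c ↦ zmodToQmodZ (p ^ k) (semilocPairNK S κ θ' P M hstabK PG w n k t c)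
    map_zero' := (congrArg (zmodToQmodZ (p ^ k)) (semilocPairNK_zero_right S κ θ' P M hstabK PG w n k t)).trans (map_zero _)
    map_add' := fun c c' ↦ (congrArg (zmodToQmodZ (p ^ k)) (semilocPairNK_add_right S κ θ' P M hstabK PG w n k t c c')).trans (map_add _ _ _) }

/-- Unfolding `semilocPairNKQ`. [folklore] -/
theorem semilocPairNKQ_apply (n k : ℕ) (t : semilocCoh S κ θ' P w n k 1) (c : subgroupH1 (κ.layerSubgroup n) ↥(torsionPow M p k)) :
    semilocPairNKQ S κ θ' P M hstabK PG w n k t c =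
      (haveI : NeZero (p ^ k) := ⟨pow_ne_zero _ (Fact.out : p.Prime).ne_zero⟩
       zmodToQmodZ (p ^ k) (semilocPairNK S κ θ' P M hstabK PG w n k t c)) :=
  rfl

/-- `semilocPairNKQ` is additive in the semilocal class. [cite: MilneADT2006, Ch. I, Cor. 2.3] -/
theorem semilocPairNKQ_add (n k : ℕ) (t t' : semilocCoh S κ θ' P w n k 1) :
    semilocPairNKQ S κ θ' P M hstabK PG w n k (t + t') = semilocPairNKQ S κ θ' P M hstabK PG w n k t + semilocPairNKQ S κ θ' P M hstabK PG w n k t' := by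
  ext c
  rw [AddMonoidHom.add_apply, semilocPairNKQ_apply, semilocPairNKQ_apply, semilocPairNKQ_apply, semilocPairNK_add_left, map_add]

/-- `semilocPairNKQ` is subtractive in the semilocal class. [folklore] -/
theorem semilocPairNKQ_sub (n k : ℕ) (t t' : semilocCoh S κ θ' P w n k 1) :
    semilocPairNKQ S κ θ' P M hstabK PG w n k (t - t') = semilocPairNKQ S κ θ' P M hstabK PG w n k t - semilocPairNKQ S κ θ' P M hstabK PG w n k t' := by
  rw [eq_sub_iff_add_eq, ← semilocPairNKQ_add, sub_add_cancel]

/-- **L1 in `ℚ/ℤ` (cores ⊣ res)**: `⟨semilocCores t, ·⟩_{n,k} = ⟨t, res_{U_{n+1}} ·⟩_{n+1,k}`. [cite: NeukirchSchmidtWingberg2008, I §5 Prop. (1.5.3)(iv)] -/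
theorem semilocPairNKQ_semilocCores (n k : ℕ) (t : semilocCoh S κ θ' P w (n + 1) k 1) (c : subgroupH1 (κ.layerSubgroup n) ↥(torsionPow M p k)) :
    semilocPairNKQ S κ θ' P M hstabK PG w n k (semilocCores S κ θ' P w n k 1 t) c =
      semilocPairNKQ S κ θ' P M hstabK PG w (n + 1) k t (resOfLe ↥(torsionPow M p k) (κ.layerSubgroup_antitone (Nat.le_succ n)) c) := by
  rw [semilocPairNKQ_apply, semilocPairNKQ_apply, semilocPairNK_semilocCores, resLe_torsRep_eq_resOfLe]

variable (hPred : ∀ (k : ℕ) (x : ↥(Representation.invariants ((muTwistO S θ' (k + 1)).toRepresentation.comp (ramificationSubgroup K P).subtype))) (m : ↥(torsionPow M p k)),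
    (PG (k + 1)).toLin x (AddSubgroup.inclusion (torsionPow_mono (M := M) (p := p) (Nat.le_succ k)) m) =
      muInclusion K (pow_dvd_pow p (Nat.le_succ k)) ((PG k).toLin (coeffMapO S P θ' (oMuRed S k) (oMuRed_muTwistO S θ' k) x) m))

include hPred in
/-- **L2 in `ℚ/ℤ` (red ⊣ incl)**: `⟨t, torsIncl ·⟩_{n,k+1} = ⟨semilocRed t, ·⟩_{n,k}` (`…SemilocPairLawsRed`). [cite: NeukirchSchmidtWingberg2008, (7.1.4), (7.2.6)] [cite: SerreLocalFields1979, XIII §3 Cor. 3] -/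
theorem semilocPairNKQ_torsIncl (n k : ℕ) (t : semilocCoh S κ θ' P w n (k + 1) 1) (c : subgroupH1 (κ.layerSubgroup n) ↥(torsionPow M p k)) :
    semilocPairNKQ S κ θ' P M hstabK PG w n (k + 1) t (torsIncl M p (κ.layerSubgroup n) (Nat.le_succ k) c) =
      semilocPairNKQ S κ θ' P M hstabK PG w n k (semilocRed S κ θ' P w n k 1 t) c := by
  rw [semilocPairNKQ_apply, semilocPairNKQ_apply]
  exact zmodToQmodZ_semilocPairNK_torsIncl S κ θ' P M hstabK PG hPred w n k t c

/-- **L3 in `ℚ/ℤ` (`R_γ ⊣ conj_{γ⁻¹}`)**: `⟨semilocConj γ t, ·⟩ = ⟨t, conj_{γ⁻¹} ·⟩` (`conjMap` on honda's side IS the tree's `conjH1`). [cite: SerreLocalFields1979, VII §5]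
[cite: NeukirchSchmidtWingberg2008, (7.2.6)] -/
theorem semilocPairNKQ_semilocConj (n k : ℕ) (γ : absoluteGaloisGroup K) (t : semilocCoh S κ θ' P w n k 1) (c : subgroupH1 (κ.layerSubgroup n) ↥(torsionPow M p k)) :
    semilocPairNKQ S κ θ' P M hstabK PG w n k (semilocConj S κ θ' P w n k 1 γ t) c =
      semilocPairNKQ S κ θ' P M hstabK PG w n k t (conjH1 (κ.layerSubgroup n) ↥(torsionPow M p k) γ⁻¹ c) := by
  rw [semilocPairNKQ_apply, semilocPairNKQ_apply, semilocPairNK_semilocConj, conjMap_torsRep_eq_conjH1]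

omit [NumberField K] [FiniteDimensional ℚ_[p] (padicCoeffField S)] in
/-- On `H¹(U, ·)` the morphism `torsSMulHom a k` induces the tree-side `torsScalar` (the two cohomology dialects agree definitionally). [folklore] -/
theorem cohomologyMap_subgroupRepMap_torsSMulHom [Module (padicCoeffIntegers S) M] [SMulCommClass (absoluteGaloisGroup K) (padicCoeffIntegers S) M]
    (U : Subgroup (absoluteGaloisGroup K)) (a : padicCoeffIntegers S) (k : ℕ) (c : continuousCohomology 1 (subgroupRep (torsRep M hstabK p k).toTopRep U)) :
    cohomologyMap (subgroupRepMap (torsSMulHom S M hstabK a k) U) 1 c = torsScalar M p U k a c :=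
  rfl

/-- **L4 in `ℚ/ℤ` (`H¹(a ⊗ id) ⊣ a`)**: `⟨semilocScalar a t, ·⟩ = ⟨t, torsScalar a ·⟩`, given the balance `hPsc` of honda's level pairings. [cite: Rubin2000, §4.2] -/
theorem semilocPairNKQ_semilocScalar [Module (padicCoeffIntegers S) M] [SMulCommClass (absoluteGaloisGroup K) (padicCoeffIntegers S) M]
    (hPsc : ∀ (k : ℕ) (a : padicCoeffIntegers S) (x : ↥(Representation.invariants ((muTwistO S θ' k).toRepresentation.comp (ramificationSubgroup K P).subtype)))
      (m : ↥(torsionPow M p k)), (PG k).toLin (coeffMapO S P θ' (oMuScalar S (p ^ k) a) (oMuScalar_muTwistO S θ' k a) x) m = (PG k).toLin x (a • m))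
    (n k : ℕ) (a : padicCoeffIntegers S) (t : semilocCoh S κ θ' P w n k 1) (c : subgroupH1 (κ.layerSubgroup n) ↥(torsionPow M p k)) :
    semilocPairNKQ S κ θ' P M hstabK PG w n k (semilocScalar S κ θ' P w n k 1 a t) c =
      semilocPairNKQ S κ θ' P M hstabK PG w n k t (torsScalar M p (κ.layerSubgroup n) k a c) := by
  rw [semilocPairNKQ_apply, semilocPairNKQ_apply, semilocPairNK_semilocScalar S κ θ' P M hstabK PG w hPsc, cohomologyMap_subgroupRepMap_torsSMulHom]

end LevelQ

/-! ## §2. The layer pairing of a semilocal Iwasawa class -/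

namespace SemilocIwasawaCohomologyDataO

section Layer

variable {K : Type} [Field K] [NumberField K] {p : ℕ} [Fact p.Prime] {S : Set (PadicAlgCl p)} [FiniteDimensional ℚ_[p] (padicCoeffField S)] {κ : ZpExtension K p}
  {γ : absoluteGaloisGroup K} {θ' : absoluteGaloisGroup K →ₜ* (padicCoeffIntegers S)ˣ} {P : Set (HeightOneSpectrum (𝓞 K))} {w : HeightOneSpectrum (𝓞 K)}
  (L : SemilocIwasawaCohomologyDataO S κ γ θ' P w 1)
  (M : Type) [AddCommGroup M] [TopologicalSpace M] [DiscreteTopology M] [DistribMulAction (absoluteGaloisGroup K) M]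
  (hstabK : ∀ m : M, IsOpen (MulAction.stabilizer (absoluteGaloisGroup K) m : Set (absoluteGaloisGroup K)))
  (PG : ∀ k : ℕ, ContPairing (coeffRepK S θ' P k).toTopRep (torsRep M hstabK p k).toTopRep (mu K (p ^ k)).toTopRep)
  (hPred : ∀ (k : ℕ) (x : ↥(Representation.invariants ((muTwistO S θ' (k + 1)).toRepresentation.comp (ramificationSubgroup K P).subtype))) (m : ↥(torsionPow M p k)),
    (PG (k + 1)).toLin x (AddSubgroup.inclusion (torsionPow_mono (M := M) (p := p) (Nat.le_succ k)) m) =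
      muInclusion K (pow_dvd_pow p (Nat.le_succ k)) ((PG k).toLin (coeffMapO S P θ' (oMuRed S k) (oMuRed_muTwistO S θ' k) x) m))
  (hM : ∀ m : M, ∃ k : ℕ, p ^ k • m = 0)

/-- **The pairing of `h ∈ 𝐇¹_{Iw,w}` with a TORSION-LEVEL global layer class** `ℓ ∈ H¹(U_n, M[p^k])`: `⟨proj_{n,k} h, semilocDual ℓ⟩_{w,n,k} / p^k ∈ ℚ/ℤ` (additive in `ℓ`).
[cite: PerrinRiou1994Invent, §3.6.1] [cite: Rubin2000, §4.2] -/
def pairLevel (n k : ℕ) (h : L.H) : subgroupH1 (κ.layerSubgroup n) ↥(torsionPow M p k) →+ AddCircle (1 : ℚ) :=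
  semilocPairNKQ S κ θ' P M hstabK PG w n k (L.proj n k h)

/-- Unfolding `pairLevel`. [folklore] -/
theorem pairLevel_apply (n k : ℕ) (h : L.H) (ℓ : subgroupH1 (κ.layerSubgroup n) ↥(torsionPow M p k)) :
    L.pairLevel M hstabK PG n k h ℓ = semilocPairNKQ S κ θ' P M hstabK PG w n k (L.proj n k h) ℓ :=
  rfl

/-- `pairLevel` is additive in `h`. [folklore] -/
theorem pairLevel_add (n k : ℕ) (h h' : L.H) : L.pairLevel M hstabK PG n k (h + h') = L.pairLevel M hstabK PG n k h + L.pairLevel M hstabK PG n k h' := by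
  rw [pairLevel, pairLevel, pairLevel, map_add, semilocPairNKQ_add]

/-- `pairLevel n k 0 = 0`. [folklore] -/
theorem pairLevel_zero (n k : ℕ) : L.pairLevel M hstabK PG n k 0 = 0 := by
  have h := L.pairLevel_add M hstabK PG n k 0 0
  rw [add_zero] at h
  exact left_eq_add.mp h

include hPred in
/-- One step of the level independence: `⟨proj_{n,k+1} h, torsIncl ℓ⟩_{k+1} = ⟨proj_{n,k} h, ℓ⟩_k` (L2 + (P2) `proj_red`). [cite: Rubin2000, §4.2] [cite: NeukirchSchmidtWingberg2008, (7.1.4)] -/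
theorem pairLevel_torsIncl_succ (n k : ℕ) (h : L.H) (ℓ : subgroupH1 (κ.layerSubgroup n) ↥(torsionPow M p k)) :
    L.pairLevel M hstabK PG n (k + 1) h (torsIncl M p (κ.layerSubgroup n) (Nat.le_succ k) ℓ) = L.pairLevel M hstabK PG n k h ℓ := by
  rw [pairLevel_apply, pairLevel_apply, semilocPairNKQ_torsIncl S κ θ' P M hstabK PG w hPred, L.proj_red]

include hPred in
/-- ★ **Independence of the torsion level along `torsIncl`**: `⟨proj_{n,k′} h, incl_{k→k′} ℓ⟩_{k′} = ⟨proj_{n,k} h, ℓ⟩_k` for `k ≤ k′`. [cite: Rubin2000, §4.2] [cite: Kato2004Asterisque, §8.2 (p. 180)] -/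
theorem pairLevel_torsIncl (n : ℕ) (h : L.H) {k k' : ℕ} (hk : k ≤ k') (ℓ : subgroupH1 (κ.layerSubgroup n) ↥(torsionPow M p k)) :
    L.pairLevel M hstabK PG n k' h (torsIncl M p (κ.layerSubgroup n) hk ℓ) = L.pairLevel M hstabK PG n k h ℓ := by
  induction k', hk using Nat.le_induction with
  | base => rw [torsIncl_le_refl]
  | succ k' hk ih => rw [← torsIncl_torsIncl (κ.layerSubgroup n) hk (Nat.le_succ k') ℓ, L.pairLevel_torsIncl_succ M hstabK PG hPred, ih]

include hPred hM in
/-- ★★ **Independence of the finite-level lift**: if `ℓ ∈ H¹(U_n, M[p^k])` and `ℓ′ ∈ H¹(U_n, M[p^{k′}])` have the same image in `H¹(U_n, M)`, then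
`⟨proj_{n,k} h, ℓ⟩_k = ⟨proj_{n,k′} h, ℓ′⟩_{k′}` (push both to `max k k′`, the difference dies deeper by the kernel control, level independence again). [cite: Rubin2000, §4.2, App. B.2]
[cite: Kato2004Asterisque, §8.2 (p. 180)] -/
theorem pairLevel_eq_of_torsToH1_eq (h : L.H) {n k k' : ℕ} (ℓ : subgroupH1 (κ.layerSubgroup n) ↥(torsionPow M p k)) (ℓ' : subgroupH1 (κ.layerSubgroup n) ↥(torsionPow M p k'))
    (he : torsToH1 M p (κ.layerSubgroup n) k ℓ = torsToH1 M p (κ.layerSubgroup n) k' ℓ') :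
    L.pairLevel M hstabK PG n k h ℓ = L.pairLevel M hstabK PG n k' h ℓ' := by
  have hd : torsToH1 M p (κ.layerSubgroup n) (max k k')
      (torsIncl M p (κ.layerSubgroup n) (le_max_left k k') ℓ - torsIncl M p (κ.layerSubgroup n) (le_max_right k k') ℓ') = 0 := by
    rw [map_sub, torsToH1_torsIncl, torsToH1_torsIncl, he, sub_self]
  obtain ⟨k'', hk'', h0⟩ := exists_torsIncl_eq_zero_of_torsToH1_eq_zero (κ.layerSubgroup n) hM _ _ hd
  rw [← L.pairLevel_torsIncl M hstabK PG hPred n h (le_max_left k k') ℓ, ← L.pairLevel_torsIncl M hstabK PG hPred n h (le_max_right k k') ℓ', ← sub_eq_zero,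
    ← map_sub, ← L.pairLevel_torsIncl M hstabK PG hPred n h hk'', h0, map_zero]

/-- A torsion level carrying a given class of `H¹(U_n, M)` (a choice; exhaustion `exists_torsToH1_eq`, `U_n` compact, `M` `p`-primary). [cite: SerreGaloisCohomology1997, I §2.2] -/
def liftLevel (n : ℕ) (c : subgroupH1 (κ.layerSubgroup n) M) : ℕ :=
  (haveI := compactSpace_layerSubgroup κ n; exists_torsToH1_eq (κ.layerSubgroup n) hM c).choose

/-- A torsion-level lift of a class of `H¹(U_n, M)` (a choice). [cite: SerreGaloisCohomology1997, I §2.2] -/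
def lift (n : ℕ) (c : subgroupH1 (κ.layerSubgroup n) M) : subgroupH1 (κ.layerSubgroup n) ↥(torsionPow M p (liftLevel (κ := κ) M hM n c)) :=
  (haveI := compactSpace_layerSubgroup κ n; exists_torsToH1_eq (κ.layerSubgroup n) hM c).choose_spec.choose

omit [NumberField K] in
/-- The chosen lift maps to the class. [cite: SerreGaloisCohomology1997, I §2.2] -/
theorem torsToH1_lift (n : ℕ) (c : subgroupH1 (κ.layerSubgroup n) M) : torsToH1 M p (κ.layerSubgroup n) (liftLevel (κ := κ) M hM n c) (lift (κ := κ) M hM n c) = c :=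
  (haveI := compactSpace_layerSubgroup κ n; exists_torsToH1_eq (κ.layerSubgroup n) hM c).choose_spec.choose_spec

/-- The layer pairing `⟨h, c⟩_{w,n}` as a bare function: pair with the chosen lift. [cite: PerrinRiou1994Invent, §3.6.1] -/
def pairLayerFun (n : ℕ) (h : L.H) (c : subgroupH1 (κ.layerSubgroup n) M) : AddCircle (1 : ℚ) :=
  L.pairLevel M hstabK PG n (liftLevel (κ := κ) M hM n c) h (lift (κ := κ) M hM n c)

include hPred in
/-- `pairLayerFun n h c = ⟨proj_{n,k} h, ℓ⟩_k` for EVERY lift `ℓ` of `c`. [cite: PerrinRiou1994Invent, §3.6.1] [cite: Rubin2000, §4.2] -/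
theorem pairLayerFun_eq (n : ℕ) (h : L.H) {k : ℕ} (ℓ : subgroupH1 (κ.layerSubgroup n) ↥(torsionPow M p k)) (c : subgroupH1 (κ.layerSubgroup n) M)
    (hℓ : torsToH1 M p (κ.layerSubgroup n) k ℓ = c) :
    L.pairLayerFun M hstabK PG hM n h c = L.pairLevel M hstabK PG n k h ℓ :=
  L.pairLevel_eq_of_torsToH1_eq M hstabK PG hPred hM h _ ℓ ((torsToH1_lift (κ := κ) M hM n c).trans hℓ.symm)

/-- ★★ **THE SEMILOCAL LAYER PAIRING `⟨·, ·⟩_{w,n} : 𝐇¹_{Iw,w} →+ Hom(H¹(U_n, M), ℚ/ℤ)`** of a semilocal Iwasawa class with the classes of the GLOBAL layer `U_n = Gal(K̄/K_n)`: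
`⟨h, c⟩_{w,n} = ⟨proj_{n,k} h, semilocDual ℓ⟩_{w,n,k} / p^k` for any torsion-level lift `ℓ` of `c` (well defined by `pairLevel_eq_of_torsToH1_eq`; additive in both variables).
[cite: PerrinRiou1994Invent, §3.6.1] [cite: Kato2004Asterisque, §17.13] [cite: Rubin2000, §4.2, App. B.2–B.3] -/
def pairLayer (n : ℕ) : L.H →+ (subgroupH1 (κ.layerSubgroup n) M →+ AddCircle (1 : ℚ)) where
  toFun h :=
    { toFun := L.pairLayerFun M hstabK PG hM n h
      map_zero' := by
        rw [L.pairLayerFun_eq M hstabK PG hPred hM n h (k := 0) 0 0 (map_zero _), map_zero]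
      map_add' := fun c d ↦ by
        haveI := compactSpace_layerSubgroup κ n
        obtain ⟨k, ℓ, hℓ⟩ := exists_torsToH1_eq (κ.layerSubgroup n) hM c
        obtain ⟨k', ℓ', hℓ'⟩ := exists_torsToH1_eq (κ.layerSubgroup n) hM d
        have hc : torsToH1 M p (κ.layerSubgroup n) (max k k') (torsIncl M p (κ.layerSubgroup n) (le_max_left k k') ℓ) = c := by rw [torsToH1_torsIncl, hℓ]
        have hd : torsToH1 M p (κ.layerSubgroup n) (max k k') (torsIncl M p (κ.layerSubgroup n) (le_max_right k k') ℓ') = d := by rw [torsToH1_torsIncl, hℓ']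
        rw [L.pairLayerFun_eq M hstabK PG hPred hM n h _ c hc, L.pairLayerFun_eq M hstabK PG hPred hM n h _ d hd,
          L.pairLayerFun_eq M hstabK PG hPred hM n h (torsIncl M p (κ.layerSubgroup n) (le_max_left k k') ℓ + torsIncl M p (κ.layerSubgroup n) (le_max_right k k') ℓ')
            (c + d) (by rw [map_add, hc, hd]), map_add] }
  map_zero' := by
    ext c
    change L.pairLayerFun M hstabK PG hM n 0 c = 0
    rw [pairLayerFun, pairLevel_zero, AddMonoidHom.zero_apply]
  map_add' := fun h h' ↦ by
    ext c
    change L.pairLayerFun M hstabK PG hM n (h + h') c = L.pairLayerFun M hstabK PG hM n h c + L.pairLayerFun M hstabK PG hM n h' c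
    simp only [pairLayerFun, pairLevel_add, AddMonoidHom.add_apply]

/-- Unfolding `pairLayer` (definitional). [folklore] -/
theorem pairLayer_apply (n : ℕ) (h : L.H) (c : subgroupH1 (κ.layerSubgroup n) M) :
    L.pairLayer M hstabK PG hPred hM n h c = L.pairLayerFun M hstabK PG hM n h c :=
  rfl

/-- ★ `⟨h, torsToH1 ℓ⟩_{w,n} = ⟨proj_{n,k} h, ℓ⟩_{w,n,k} / p^k`. [cite: PerrinRiou1994Invent, §3.6.1] [cite: Rubin2000, §4.2] -/
theorem pairLayer_apply_torsToH1 (n : ℕ) (h : L.H) {k : ℕ} (ℓ : subgroupH1 (κ.layerSubgroup n) ↥(torsionPow M p k)) :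
    L.pairLayer M hstabK PG hPred hM n h (torsToH1 M p (κ.layerSubgroup n) k ℓ) = L.pairLevel M hstabK PG n k h ℓ := by
  rw [pairLayer_apply]
  exact L.pairLayerFun_eq M hstabK PG hPred hM n h ℓ _ rfl

/-! ## §3. Laws of the layer pairing -/

/-- One step of the restriction compatibility: `⟨h, res_{U_{n+1}} c⟩_{w,n+1} = ⟨h, c⟩_{w,n}` (L1 cores ⊣ res + (P1) `proj_cores` + `torsToH1_resOfLe`). [cite: NeukirchSchmidtWingberg2008, I §5 Prop. (1.5.3)(iv)]
[cite: Kato2004Asterisque, §17.13] -/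
theorem pairLayer_resOfLe_succ (n : ℕ) (h : L.H) (c : subgroupH1 (κ.layerSubgroup n) M) :
    L.pairLayer M hstabK PG hPred hM (n + 1) h (resOfLe M (κ.layerSubgroup_antitone (Nat.le_succ n)) c) = L.pairLayer M hstabK PG hPred hM n h c := by
  haveI := compactSpace_layerSubgroup κ n
  obtain ⟨k, ℓ, rfl⟩ := exists_torsToH1_eq (κ.layerSubgroup n) hM c
  rw [← torsToH1_resOfLe, pairLayer_apply_torsToH1, pairLayer_apply_torsToH1, pairLevel_apply, pairLevel_apply, ← L.proj_cores n k h, semilocPairNKQ_semilocCores]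

/-- ★ **Compatibility with restriction along the global tower**: `⟨h, res_{U_m ≤ U_n} c⟩_{w,m} = ⟨h, c⟩_{w,n}` for `n ≤ m` — the projection formula for the cores-compatible family
`(proj_{n,k} h)_n`. [cite: NeukirchSchmidtWingberg2008, I §5 Prop. (1.5.3)(iv)] [cite: Kato2004Asterisque, §17.13] -/
theorem pairLayer_resOfLe {n m : ℕ} (hnm : n ≤ m) (h : L.H) (c : subgroupH1 (κ.layerSubgroup n) M) :
    L.pairLayer M hstabK PG hPred hM m h (resOfLe M (κ.layerSubgroup_antitone hnm) c) = L.pairLayer M hstabK PG hPred hM n h c := by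
  induction m, hnm using Nat.le_induction with
  | base => rw [resOfLe_refl_holds, AddMonoidHom.id_apply]
  | succ m hnm ih =>
    have hcomp := DFunLike.congr_fun (resOfLe_comp_holds (M := M) (κ.layerSubgroup_antitone (Nat.le_succ m)) (κ.layerSubgroup_antitone hnm)) c
    rw [AddMonoidHom.comp_apply] at hcomp
    rw [← hcomp, pairLayer_resOfLe_succ, ih]

/-- ★ **The conjugation law**: `⟨T·h, c⟩_{w,n} = ⟨h, conj_{γ⁻¹} c⟩_{w,n} − ⟨h, c⟩_{w,n}` — (P5) `proj (T·h) = R_γ(proj h) − proj h`, L3 `R_γ ⊣ conj_{γ⁻¹}`, `torsToH1 ∘ conj = conj ∘ torsToH1`. For honda's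
orientation `γ := γK⁻¹` this is `conj_{γK} − 1` on the A-side — the action forced on the duals `Y′`, `Y″` (`strictDualModule`, `locImageDualModule`). [cite: Kato2004Asterisque, §17.13]
[cite: NeukirchSchmidtWingberg2008, (7.2.6)] [cite: SerreLocalFields1979, VII §5] -/
theorem pairLayer_X_smul (n : ℕ) (h : L.H) (c : subgroupH1 (κ.layerSubgroup n) M) :
    L.pairLayer M hstabK PG hPred hM n ((PowerSeries.X : IwasawaAlgebraO S) • h) c =
      L.pairLayer M hstabK PG hPred hM n h (conjH1 (κ.layerSubgroup n) M γ⁻¹ c) - L.pairLayer M hstabK PG hPred hM n h c := by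
  haveI := compactSpace_layerSubgroup κ n
  obtain ⟨k, ℓ, rfl⟩ := exists_torsToH1_eq (κ.layerSubgroup n) hM c
  rw [← torsToH1_conjH1, pairLayer_apply_torsToH1, pairLayer_apply_torsToH1, pairLayer_apply_torsToH1, pairLevel_apply, pairLevel_apply, pairLevel_apply, L.proj_X_smul,
    semilocPairNKQ_sub, AddMonoidHom.sub_apply, semilocPairNKQ_semilocConj]

/-- ★ **The `𝒪`-balance**: `⟨C a·h, c⟩_{w,n} = ⟨h, a·c⟩_{w,n}` — (P7) `proj (C a·h) = (a ⊗ id)(proj h)`, L4 `H¹(a ⊗ id) ⊣ a` (given the balance `hPsc` of honda's level pairings),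
`torsToH1 ∘ torsScalar a = scalarH1 a ∘ torsToH1`. [cite: Kato2004Asterisque, §17.13] [cite: Rubin2000, §4.2] -/
theorem pairLayer_C_smul [Module (padicCoeffIntegers S) M] [SMulCommClass (absoluteGaloisGroup K) (padicCoeffIntegers S) M]
    (hPsc : ∀ (k : ℕ) (a : padicCoeffIntegers S) (x : ↥(Representation.invariants ((muTwistO S θ' k).toRepresentation.comp (ramificationSubgroup K P).subtype)))
      (m : ↥(torsionPow M p k)), (PG k).toLin (coeffMapO S P θ' (oMuScalar S (p ^ k) a) (oMuScalar_muTwistO S θ' k a) x) m = (PG k).toLin x (a • m))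
    (n : ℕ) (a : padicCoeffIntegers S) (h : L.H) (c : subgroupH1 (κ.layerSubgroup n) M) :
    L.pairLayer M hstabK PG hPred hM n ((PowerSeries.C a : IwasawaAlgebraO S) • h) c =
      L.pairLayer M hstabK PG hPred hM n h (GreenbergSelmer.scalarH1 (κ.layerSubgroup n) M a c) := by
  haveI := compactSpace_layerSubgroup κ n
  obtain ⟨k, ℓ, rfl⟩ := exists_torsToH1_eq (κ.layerSubgroup n) hM c
  rw [← torsToH1_torsScalar, pairLayer_apply_torsToH1, pairLayer_apply_torsToH1, pairLevel_apply, pairLevel_apply, L.proj_C_smul,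
    semilocPairNKQ_semilocScalar S κ θ' P M hstabK PG w hPsc]

end Layer

end SemilocIwasawaCohomologyDataO

end Summit.BirchSwinnertonDyer.BirchSwinnertonDyer.Theorems.SmallImageRttD2Seq

end
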